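import Mathlib
import HarnessLib
import Summits.KontsevichZagierPeriods.Zeta5Search.Denom.TwoTaleP15Decay
import Summits.KontsevichZagierPeriods.Zeta5Search.Denom.KernelStripStep

/-!
# P15 two-tale forms — the strip shift `StripShift` PROVED

HONEST FRAMING: systematic search; no irrationality claim unless certified.  This file is pure complex
analysis: it proves the sub-input `TwoTaleP15Decay.StripShift` of the decay decomposition
(`TwoTaleP15Decay.decay_of_lineBound`) — the vertical line of the Barnes-type integral
`(1/2π) ∫ (π/sin π(x+iy))² R(x − a₂* + iy) dy` (Zudilin 2014, arXiv:1310.1526, Prop. 1 (P4), at the point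
P15 `a = (13n+1, 11n+1, 9n+1, 15n+1)`, `b = (1, 2n+1, 4n+1, 26n+2)`, `a₂* = 11n+1`) may be moved from
`x = ½` to any half-integer abscissa `x = m + ½`, `m ≤ 9n`.  It claims NO measure of `ζ(2)` and proves no
arithmetic.

Method: iterate the abstract unit step `KernelStripStep.integral_kernel_step` over the integers
`m = 1, …, 9n`.  At each such `m` the shifted rational function `g(t) = R(t − a₂*)` has a DOUBLE zero
(the factor `t − a₂* + i`, `i = a₂* − m ∈ [2n+1, 11n]`, occurs in the blocks `i ∈ [1, 13n]` and
`i ∈ [2n+1, 11n]`), is holomorphic on `Re t ≥ ½` (the polar factors `t − a₂* + i`, `i ≥ 15n+1`, have real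
part `≥ 4n + ½`), and is bounded by `A·(1 + (Im t)²)^{14n}` on each strip (a product of `27n` linear factors).

Main results: `stripShift_holds : StripShift`; the corollaries `decay_of_lineBound'` and
`zetaTwo_exponent_le_of_lineBound'` = the statements of `TwoTaleP15Decay` with the `StripShift`
hypothesis discharged (the remaining named inputs `LineRep`, the line bound, `Inclusion`, `CoeffRate` are
NOT tree theorems).
References: W. Zudilin, arXiv:1310.1526 [Zudilin2014ZetaTwo] Prop. 1, Lemma 6.
-/

noncomputable section

open Complex Set MeasureTheory Filter Topology Finset
open Literature.NumberTheory.Transcendental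
open Summit.KontsevichZagierPeriods.Zeta5Search
open Summit.KontsevichZagierPeriods.Zeta5Search.Denom.TwoTaleP15Forms
open Summit.KontsevichZagierPeriods.Zeta5Search.Denom.TwoTaleP15Decay
open Summit.KontsevichZagierPeriods.Zeta5Search.Denom.KernelStripStep

namespace Summit.KontsevichZagierPeriods.Zeta5Search.Denom.TwoTaleP15StripShift

/-! ### The blocks of `R(t − a₂*)` -/

/-- A block `∏_{i ∈ [lo, hi)} (t − a₂* + i)` of `R(t − a₂*)`, `a₂* = 11n + 1`, as a function of `t`. -/
def p15Block (n lo hi : ℕ) (t : ℂ) : ℂ := ∏ i ∈ Ico lo hi, (t - (11 * n + 1) + i)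

/-- The shifted rational function `g(t) = R(t − a₂*)` at P15. -/
def gP15 (n : ℕ) (t : ℂ) : ℂ := ratRC n (t - (11 * n + 1))

/-- `g` as a product of three numerator blocks and the polar block. -/
theorem gP15_eq (n : ℕ) (t : ℂ) : gP15 n t =
    p15Block n 1 (13 * n + 1) t / (Nat.factorial (13 * n) : ℂ) *
      (p15Block n (2 * n + 1) (11 * n + 1) t / (Nat.factorial (9 * n) : ℂ)) *
      (p15Block n (4 * n + 1) (9 * n + 1) t / (Nat.factorial (5 * n) : ℂ)) *
      ((Nat.factorial (11 * n) : ℂ) / p15Block n (15 * n + 1) (26 * n + 2) t) := rfl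

/-- Each block is entire. -/
@[fun_prop]
theorem differentiable_p15Block (n lo hi : ℕ) : Differentiable ℂ (p15Block n lo hi) := by
  unfold p15Block
  fun_prop

/-- Real part of a factor: `Re (t − a₂* + i) = Re t − 11n − 1 + i`. -/
theorem re_p15Factor (n i : ℕ) (t : ℂ) : (t - (11 * n + 1) + i).re = t.re - (11 * n + 1) + i := by
  have : (t - (11 * n + 1) + i : ℂ) = t + (((i : ℝ) - (11 * n + 1) : ℝ) : ℂ) := by
    push_cast
    ring
  rw [this, add_re, ofReal_re]
  ring

/-- A polar factor has real part `≥ 4n + ½` on `Re t ≥ ½`. -/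
theorem re_p15Factor_ge {n i : ℕ} (hi : 15 * n + 1 ≤ i) {t : ℂ} (ht : 1 / 2 ≤ t.re) :
    4 * n + 1 / 2 ≤ (t - (11 * n + 1) + i).re := by
  have h : ((15 * n + 1 : ℕ) : ℝ) ≤ (i : ℝ) := by exact_mod_cast hi
  push_cast at h
  rw [re_p15Factor]
  linarith

/-- The polar block does not vanish on `Re t ≥ ½`. -/
theorem p15Polar_ne_zero {n : ℕ} {t : ℂ} (ht : 1 / 2 ≤ t.re) : p15Block n (15 * n + 1) (26 * n + 2) t ≠ 0 := by
  rw [p15Block]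
  refine Finset.prod_ne_zero_iff.2 fun i hi h => ?_
  have h1 := re_p15Factor_ge (n := n) (Finset.mem_Ico.1 hi).1 ht
  rw [h, zero_re] at h1
  have : (0 : ℝ) ≤ 4 * n := by positivity
  linarith

/-- The polar block has norm `≥ 1` on `Re t ≥ ½` (`n ≥ 1`). -/
theorem one_le_norm_p15Polar {n : ℕ} (hn : 1 ≤ n) {t : ℂ} (ht : 1 / 2 ≤ t.re) :
    1 ≤ ‖p15Block n (15 * n + 1) (26 * n + 2) t‖ := by
  rw [p15Block, norm_prod]
  refine Finset.one_le_prod fun i hi => ?_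
  have h1 := re_p15Factor_ge (n := n) (Finset.mem_Ico.1 hi).1 ht
  have hn' : (1 : ℝ) ≤ n := by exact_mod_cast hn
  exact le_trans (by linarith) (re_le_norm _)

/-- A block containing the index `a₂* − m` vanishes at `t = m`. -/
theorem p15Block_natCast_eq_zero {n lo hi m : ℕ} (hlo : lo + m ≤ 11 * n + 1) (hhi : 11 * n + 1 < hi + m) :
    p15Block n lo hi (m : ℂ) = 0 := by
  rw [p15Block]
  have hm : m ≤ 11 * n + 1 := by omega
  refine Finset.prod_eq_zero (i := 11 * n + 1 - m) (Finset.mem_Ico.2 ⟨by omega, by omega⟩) ?_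
  rw [Nat.cast_sub hm]
  push_cast
  ring

/-! ### The hypotheses of the unit step at `m = 1, …, 9n` -/

/-- `g(m) = 0` for `1 ≤ m ≤ 9n`. -/
theorem gP15_natCast {n m : ℕ} (h1 : 1 ≤ m) (h9 : m ≤ 9 * n) : gP15 n (m : ℂ) = 0 := by
  rw [gP15_eq, p15Block_natCast_eq_zero (lo := 1) (hi := 13 * n + 1) (by omega) (by omega)]
  simp

/-- On the strip around `m ≥ 1`, `Re t ≥ ½`. -/
theorem half_le_re_of_mem_halfStrip {m : ℕ} (h1 : 1 ≤ m) {t : ℂ} (ht : t ∈ halfStrip (m : ℤ)) : 1 / 2 ≤ t.re := by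
  simp only [halfStrip, Set.mem_preimage, Set.mem_Icc, Int.cast_natCast] at ht
  have : (1 : ℝ) ≤ m := by exact_mod_cast h1
  linarith [ht.1]

/-- `g` is holomorphic on the closed strip `|Re t − m| ≤ ½`, `m ≥ 1`. -/
theorem differentiableOn_gP15 (n : ℕ) {m : ℕ} (h1 : 1 ≤ m) :
    DifferentiableOn ℂ (gP15 n) (halfStrip (m : ℤ)) := by
  have hden : ∀ t ∈ halfStrip (m : ℤ), p15Block n (15 * n + 1) (26 * n + 2) t ≠ 0 :=
    fun t ht => p15Polar_ne_zero (half_le_re_of_mem_halfStrip h1 ht)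
  have hfun : gP15 n = fun t => p15Block n 1 (13 * n + 1) t / (Nat.factorial (13 * n) : ℂ) *
      (p15Block n (2 * n + 1) (11 * n + 1) t / (Nat.factorial (9 * n) : ℂ)) *
      (p15Block n (4 * n + 1) (9 * n + 1) t / (Nat.factorial (5 * n) : ℂ)) *
      ((Nat.factorial (11 * n) : ℂ) / p15Block n (15 * n + 1) (26 * n + 2) t) := rfl
  rw [hfun]
  fun_prop (disch := first | assumption | exact hden)

/-- `g'(m) = 0` for `1 ≤ m ≤ 9n` (two vanishing blocks ⇒ every term of the product rule vanishes). -/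
theorem deriv_gP15_natCast {n m : ℕ} (h1 : 1 ≤ m) (h9 : m ≤ 9 * n) : deriv (gP15 n) (m : ℂ) = 0 := by
  have hB1 : p15Block n 1 (13 * n + 1) (m : ℂ) = 0 := p15Block_natCast_eq_zero (by omega) (by omega)
  have hB2 : p15Block n (2 * n + 1) (11 * n + 1) (m : ℂ) = 0 := p15Block_natCast_eq_zero (by omega) (by omega)
  have hre : 1 / 2 ≤ (m : ℂ).re := by
    rw [natCast_re]
    have : (1 : ℝ) ≤ m := by exact_mod_cast h1
    linarith
  have hden : p15Block n (15 * n + 1) (26 * n + 2) (m : ℂ) ≠ 0 := p15Polar_ne_zero hre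
  have hA : HasDerivAt (fun t => p15Block n 1 (13 * n + 1) t / (Nat.factorial (13 * n) : ℂ)) _ (m : ℂ) :=
    ((differentiable_p15Block n 1 (13 * n + 1)).differentiableAt.hasDerivAt).div_const _
  have hB : HasDerivAt (fun t => p15Block n (2 * n + 1) (11 * n + 1) t / (Nat.factorial (9 * n) : ℂ)) _
      (m : ℂ) :=
    ((differentiable_p15Block n (2 * n + 1) (11 * n + 1)).differentiableAt.hasDerivAt).div_const _
  have hC : HasDerivAt (fun t => p15Block n (4 * n + 1) (9 * n + 1) t / (Nat.factorial (5 * n) : ℂ)) _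
      (m : ℂ) :=
    ((differentiable_p15Block n (4 * n + 1) (9 * n + 1)).differentiableAt.hasDerivAt).div_const _
  have hD : HasDerivAt (fun t => (Nat.factorial (11 * n) : ℂ) / p15Block n (15 * n + 1) (26 * n + 2) t) _
      (m : ℂ) :=
    (hasDerivAt_const (m : ℂ) (Nat.factorial (11 * n) : ℂ)).div
      ((differentiable_p15Block n (15 * n + 1) (26 * n + 2)).differentiableAt.hasDerivAt) hden
  have h : HasDerivAt (gP15 n) _ (m : ℂ) := ((hA.mul hB).mul hC).mul hD
  rw [h.deriv]
  simp [hB1, hB2]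

/-! ### Polynomial growth on the strips -/

/-- A linear factor on the strip around `m ≤ 9n`: `‖t − a₂* + i‖ ≤ (48n + 4)(1 + |Im t|)` for `i < 26n + 2`. -/
theorem norm_p15Factor_le {n m i : ℕ} (hm : m ≤ 9 * n) (hi : i < 26 * n + 2) {t : ℂ}
    (ht : t ∈ halfStrip (m : ℤ)) : ‖t - (11 * n + 1) + i‖ ≤ (48 * n + 4) * (1 + |t.im|) := by
  simp only [halfStrip, Set.mem_preimage, Set.mem_Icc, Int.cast_natCast] at ht
  have hm' : (m : ℝ) ≤ 9 * n := by exact_mod_cast hm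
  have hi' : (i : ℝ) ≤ 26 * n + 1 := by
    have : i ≤ 26 * n + 1 := by omega
    exact_mod_cast this
  have hn : (0 : ℝ) ≤ n := Nat.cast_nonneg n
  have h1 : ‖t - (11 * n + 1) + i‖ ≤ ‖t‖ + ‖((11 * n + 1 : ℕ) : ℂ)‖ + ‖(i : ℂ)‖ := by
    calc ‖t - (11 * n + 1) + i‖ ≤ ‖t - (11 * n + 1)‖ + ‖(i : ℂ)‖ := norm_add_le _ _
      _ ≤ ‖t‖ + ‖((11 * n + 1 : ℕ) : ℂ)‖ + ‖(i : ℂ)‖ := by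
          gcongr
          push_cast
          exact norm_sub_le _ _
  rw [Complex.norm_natCast, Complex.norm_natCast] at h1
  push_cast at h1
  have h2 : ‖t‖ ≤ |t.re| + |t.im| := norm_le_abs_re_add_abs_im t
  have h3 : |t.re| ≤ 9 * n + 1 := by
    rw [abs_le]
    constructor <;> linarith [ht.1, ht.2]
  have h4 : 0 ≤ |t.im| := abs_nonneg _
  nlinarith [mul_nonneg (by positivity : (0 : ℝ) ≤ 48 * n + 3) h4]

/-- A block on the strip around `m ≤ 9n`: `‖p15Block n lo hi t‖ ≤ ((48n+4)(1+|Im t|))^{hi − lo}` (`hi ≤ 26n+2`). -/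
theorem norm_p15Block_le {n m lo hi : ℕ} (hm : m ≤ 9 * n) (hhi : hi ≤ 26 * n + 2) {t : ℂ}
    (ht : t ∈ halfStrip (m : ℤ)) : ‖p15Block n lo hi t‖ ≤ ((48 * n + 4) * (1 + |t.im|)) ^ (hi - lo) := by
  rw [p15Block, norm_prod, ← Nat.card_Ico lo hi, ← Finset.prod_const]
  refine Finset.prod_le_prod (fun i _ => norm_nonneg _) fun i hi' => ?_
  exact norm_p15Factor_le hm (by have := (Finset.mem_Ico.1 hi').2; omega) ht

/-- `(1 + |y|)² ≤ 2 (1 + y²)`. -/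
theorem one_add_abs_sq_le_two_mul (y : ℝ) : (1 + |y|) ^ 2 ≤ 2 * (1 + y ^ 2) := by
  nlinarith [sq_abs y, sq_nonneg (|y| - 1), abs_nonneg y]

/-- **Growth**: on the strip around `m ∈ [1, 9n]`, `‖g(t)‖ ≤ A · (1 + (Im t)²)^{14n}` with
`A = (11n)! (48n+4)^{27n} 2^{14n}`. -/
theorem norm_gP15_le {n m : ℕ} (hn : 1 ≤ n) (h1 : 1 ≤ m) (hm : m ≤ 9 * n) {t : ℂ}
    (ht : t ∈ halfStrip (m : ℤ)) :
    ‖gP15 n t‖ ≤ ((Nat.factorial (11 * n) : ℝ) * (48 * n + 4) ^ (27 * n) * 2 ^ (14 * n)) *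
      (1 + t.im ^ 2) ^ (14 * n) := by
  have hre : 1 / 2 ≤ t.re := half_le_re_of_mem_halfStrip h1 ht
  set b : ℝ := (48 * n + 4) * (1 + |t.im|) with hb
  have hb1 : 1 ≤ 1 + |t.im| := le_add_of_nonneg_right (abs_nonneg _)
  have hB1 := norm_p15Block_le (lo := 1) (hi := 13 * n + 1) hm (by omega) ht
  have hB2 := norm_p15Block_le (lo := 2 * n + 1) (hi := 11 * n + 1) hm (by omega) ht
  have hB3 := norm_p15Block_le (lo := 4 * n + 1) (hi := 9 * n + 1) hm (by omega) ht
  have e1 : 13 * n + 1 - 1 = 13 * n := by omega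
  have e2 : 11 * n + 1 - (2 * n + 1) = 9 * n := by omega
  have e3 : 9 * n + 1 - (4 * n + 1) = 5 * n := by omega
  rw [e1] at hB1
  rw [e2] at hB2
  rw [e3] at hB3
  have hD := one_le_norm_p15Polar hn hre
  have hfac : ∀ k : ℕ, (1 : ℝ) ≤ (Nat.factorial k : ℝ) := fun k => by
    exact_mod_cast Nat.succ_le_of_lt (Nat.factorial_pos k)
  have h28 : 28 * n = 2 * (14 * n) := by ring
  calc ‖gP15 n t‖
      = ‖p15Block n 1 (13 * n + 1) t‖ / (Nat.factorial (13 * n) : ℝ) *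
          (‖p15Block n (2 * n + 1) (11 * n + 1) t‖ / (Nat.factorial (9 * n) : ℝ)) *
          (‖p15Block n (4 * n + 1) (9 * n + 1) t‖ / (Nat.factorial (5 * n) : ℝ)) *
          ((Nat.factorial (11 * n) : ℝ) / ‖p15Block n (15 * n + 1) (26 * n + 2) t‖) := by
        rw [gP15_eq]
        simp only [norm_mul, norm_div, Complex.norm_natCast]
    _ ≤ ‖p15Block n 1 (13 * n + 1) t‖ * ‖p15Block n (2 * n + 1) (11 * n + 1) t‖ *
          ‖p15Block n (4 * n + 1) (9 * n + 1) t‖ * (Nat.factorial (11 * n) : ℝ) := by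
        gcongr ?_ * ?_ * ?_ * ?_
        · exact div_le_self (norm_nonneg _) (hfac _)
        · exact div_le_self (norm_nonneg _) (hfac _)
        · exact div_le_self (norm_nonneg _) (hfac _)
        · exact div_le_self (by positivity) hD
    _ ≤ b ^ (13 * n) * b ^ (9 * n) * b ^ (5 * n) * (Nat.factorial (11 * n) : ℝ) := by gcongr
    _ = (Nat.factorial (11 * n) : ℝ) * ((48 * n + 4) ^ (27 * n) * (1 + |t.im|) ^ (27 * n)) := by
        simp only [hb, mul_pow]
        ring
    _ ≤ (Nat.factorial (11 * n) : ℝ) * ((48 * n + 4) ^ (27 * n) * (1 + |t.im|) ^ (28 * n)) := by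
        have h27 : (1 + |t.im|) ^ (27 * n) ≤ (1 + |t.im|) ^ (28 * n) := pow_le_pow_right₀ hb1 (by omega)
        exact mul_le_mul_of_nonneg_left (mul_le_mul_of_nonneg_left h27 (by positivity)) (by positivity)
    _ ≤ (Nat.factorial (11 * n) : ℝ) *
          ((48 * n + 4) ^ (27 * n) * (2 ^ (14 * n) * (1 + t.im ^ 2) ^ (14 * n))) := by
        have h2 : (1 + |t.im|) ^ (28 * n) ≤ 2 ^ (14 * n) * (1 + t.im ^ 2) ^ (14 * n) := by
          rw [h28, pow_mul, ← mul_pow]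
          exact pow_le_pow_left₀ (by positivity) (one_add_abs_sq_le_two_mul t.im) _
        exact mul_le_mul_of_nonneg_left (mul_le_mul_of_nonneg_left h2 (by positivity)) (by positivity)
    _ = ((Nat.factorial (11 * n) : ℝ) * (48 * n + 4) ^ (27 * n) * 2 ^ (14 * n)) *
          (1 + t.im ^ 2) ^ (14 * n) := by ring

/-! ### The strip shift -/

/-- The integrand of `lineIntegral n x` is the kernel times `g`. -/
theorem lineIntegrand_eq_kernel_mul_gP15 (n : ℕ) (x y : ℝ) :
    kernelSq ((x : ℂ) + (y : ℂ) * I) * ratRC n ((x : ℂ) - (11 * n + 1) + (y : ℂ) * I) =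
      ((Real.pi : ℂ) / Complex.sin (Real.pi * ((x : ℂ) + (y : ℂ) * I))) ^ 2 *
        gP15 n ((x : ℂ) + (y : ℂ) * I) := by
  rw [kernelSq, gP15, add_sub_right_comm]

/-- **One step**: the line `k + 1 + ½` equals the line `k + ½` (`k + 1 ≤ 9n`). -/
theorem lineIntegral_succ {n k : ℕ} (hn : 1 ≤ n) (hk : k + 1 ≤ 9 * n) :
    lineIntegral n (((k + 1 : ℕ) : ℝ) + 1 / 2) = lineIntegral n ((k : ℝ) + 1 / 2) := by
  have h1 : 1 ≤ k + 1 := by omega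
  have eL : ((((k + 1 : ℕ) : ℤ) : ℝ) - 1 / 2 : ℝ) = (k : ℝ) + 1 / 2 := by
    push_cast
    ring
  have eR : ((((k + 1 : ℕ) : ℤ) : ℝ) + 1 / 2 : ℝ) = ((k + 1 : ℕ) : ℝ) + 1 / 2 := by
    push_cast
    ring
  have e0 : ((((k + 1 : ℕ) : ℤ)) : ℂ) = ((k + 1 : ℕ) : ℂ) := by norm_cast
  have h0 : gP15 n ((((k + 1 : ℕ) : ℤ)) : ℂ) = 0 := by
    rw [e0]
    exact gP15_natCast h1 hk
  have h0' : deriv (gP15 n) ((((k + 1 : ℕ) : ℤ)) : ℂ) = 0 := by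
    rw [e0]
    exact deriv_gP15_natCast h1 hk
  have step := integral_kernel_step (differentiableOn_gP15 n h1) h0 h0'
    (fun t ht => norm_gP15_le hn h1 hk ht)
  rw [eL, eR] at step
  unfold lineIntegral
  simp_rw [lineIntegrand_eq_kernel_mul_gP15]
  rw [step]

/-- **`StripShift` PROVED**: `lineIntegral n (m + ½) = lineIntegral n ½` for all `m ≤ 9n` (`n ≥ 1`). -/
theorem stripShift_holds : StripShift := by
  intro n hn m hm
  induction m with
  | zero => simp
  | succ k ih => rw [lineIntegral_succ hn (by omega), ih (by omega)]

/-! ### Corollaries: the `TwoTaleP15Decay` reductions with `StripShift` discharged -/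

/-- `Decay c` from the integral representation and a line bound on `x = xₙ + ½`, `xₙ ≤ 9n`. -/
theorem decay_of_lineBound' {c : ℝ} (hRep : LineRep) (x : ℕ → ℕ) (hx : ∀ n, x n ≤ 9 * n)
    (hB : ∀ᶠ n : ℕ in atTop, Real.pi / 2 *
      ∫ y : ℝ, ‖ratRC n ((((x n : ℝ) + 1 / 2 : ℝ) : ℂ) - (11 * n + 1) + (y : ℂ) * Complex.I)‖ /
        Real.cosh (Real.pi * y) ^ 2 ≤ Real.exp (-(c * n))) :
    Decay c :=
  decay_of_lineBound hRep stripShift_holds x hx hB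

/-- End to end on the decay side, `StripShift` discharged: `Inclusion`, `LineRep`, a line bound with
`c = 29.10`, `CoeffRate C₁` (`0 < C₁ ≤ 42.04`) give `ExponentLE (ζ(2)) 5.0523` — an implication only. -/
theorem zetaTwo_exponent_le_of_lineBound' {C₁ : ℝ} (hI : Inclusion) (hRep : LineRep)
    (x : ℕ → ℕ) (hx : ∀ n, x n ≤ 9 * n)
    (hB : ∀ᶠ n : ℕ in atTop, Real.pi / 2 *
      ∫ y : ℝ, ‖ratRC n ((((x n : ℝ) + 1 / 2 : ℝ) : ℂ) - (11 * n + 1) + (y : ℂ) * Complex.I)‖ /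
        Real.cosh (Real.pi * y) ^ 2 ≤ Real.exp (-(29.10 * n)))
    (hC : CoeffRate C₁) (hC₀ : 0 < C₁) (hC₁ : C₁ ≤ 42.04) : ExponentLE (zetaValue 2) 5.0523 :=
  zetaTwo_exponent_le_of_lineBound hI hRep stripShift_holds x hx hB hC hC₀ hC₁

end Summit.KontsevichZagierPeriods.Zeta5Search.Denom.TwoTaleP15StripShift

end
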